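import Literature.Algebra.EuclideanLattices.Encoding
import Literature.Computability.Complexity.AOWListMatrixFP
import HarnessLib

/-!
# Lattice instances from list matrices: the instance code is computed in polynomial time from the table

Topic `Algebra/EuclideanLattices`, namespace `Literature.Algebra.EuclideanLattices`. The last stage of
every machine that OUTPUTS a lattice problem instance (here: the machine hypothesis of Khot's reduction,
`Khot.gapSVP_const_isNPHardRandomized_of_prop6_of_FP_explicit` / `Khot2005_SAT_randReducible_gapSVP_of_…_FP_explicit`,
whose output `columnInstance (squareOf …)` is produced as a list matrix, `KhotOutputTable.lean`): from a
dimension `N` in unary and an `N × N` list matrix `X` (`LMat`: rows of integers, `ent`/`tab`/`toMat` of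
`AOWListMatrix.lean`, coded by `matE`), the code `LatticeInstance.encode ⟨N, toMat N N X⟩` of the lattice
instance whose basis matrix is the table — `⟨bin N, ⟨1^{N²}, ⟪entries in row-major order, sign–magnitude⟫⟩⟩`
(`latticeInstanceEncoding` = `sigmaBool encodingIntMatrixFin`, `Encoding.lean`) — and, with a natural
threshold `t` in binary, the code `GapSVPInstance.encode (⟨N, toMat N N X⟩, t)` are values of
polynomial-time string functions, in the typed algebra `CodeFP` (`CodeFP.lean`).

* `rowMajor N X` — the `N²` entries `ent X (m / N) (m % N)`, `m < N²`; `latticeInstance_encode_eq`,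
  `latticeInstance_encode_toMat` (the instance code IS `⟨bin N, listE smE (rowMajor N X)⟩`),
  `gapSVPInstance_encode_natCast` (a natural threshold `t` is coded `⟨⟨[false], bin t⟩, bin 1⟩`);
* `rowMajorFP`, **`latticeTableFP`** (`(1ᴺ, X) ↦ code ⟨N, toMat N N X⟩`), **`gapSVPTableFP`**
  (`((1ᴺ, X), t) ↦ code (⟨N, toMat N N X⟩, t)`).

All proved; no facts. (Arora–Barak 2009, §0.1–§1.3: codes of numbers, tuples and lists; polynomial
time is closed under composition and polynomially bounded loops.)

## References

* D. Micciancio, S. Goldwasser, *Complexity of Lattice Problems*, Kluwer 2002, Ch. 1, §1.2 (size of a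
  lattice instance), Def. 1.4.
* S. Arora, B. Barak, *Computational Complexity: A Modern Approach*, CUP 2009, §0.1, §1.3.
-/

namespace Literature.Algebra.EuclideanLattices

open _root_.Computability Literature.Computability.Complexity Literature.Computability.Complexity.CodeFP
  Literature.Computability.Complexity.LMat

/-! ### The row-major entry list and the unfolded codes -/

/-- The entries of the `N × N` window of a list matrix in row-major order: item `m < N²` is
`ent X (m / N) (m % N)` (the order of `finProdFinEquiv`, used by `encodingIntMatrixFin`).
[cite: MicciancioGoldwasser2002, Ch. 1 §1.2] -/
def rowMajor (N : ℕ) (X : List (List ℤ)) : List ℤ :=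
  (List.range (N * N)).map fun m => ent X (m / N) (m % N)

/-- `rowMajor N X` has `N²` items. [folklore] -/
theorem length_rowMajor (N : ℕ) (X : List (List ℤ)) : (rowMajor N X).length = N * N := by
  simp [rowMajor]

/-- **The code of a lattice instance, unfolded**: `⟨bin N, ⟨1^{N²}, ⟪sign–magnitude entries in
row-major order⟫⟩⟩`. [cite: MicciancioGoldwasser2002, Ch. 1 §1.2] -/
theorem latticeInstance_encode_eq (N : ℕ) (B : Matrix (Fin N) (Fin N) ℤ) :
    LatticeInstance.encode ⟨N, B⟩ =
      boolPair (encodeNat N) (listE smE (List.ofFn fun m : Fin (N * N) =>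
        B (finProdFinEquiv.symm m).1 (finProdFinEquiv.symm m).2)) := by
  show boolPair (encodeNat N) (encodingIntBool.listBool.encode (List.ofFn _)) = _
  rw [listE_eq]
  rfl

/-- **The code of the lattice instance of a table**: `code ⟨N, toMat N N X⟩ = ⟨bin N, listE smE (rowMajor N X)⟩`.
[cite: MicciancioGoldwasser2002, Ch. 1 §1.2] -/
theorem latticeInstance_encode_toMat (N : ℕ) (X : List (List ℤ)) :
    LatticeInstance.encode ⟨N, toMat N N X⟩ = boolPair (encodeNat N) (listE smE (rowMajor N X)) := by
  rw [latticeInstance_encode_eq]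
  congr 2
  refine List.ext_getElem (by simp [rowMajor]) fun i h₁ h₂ => ?_
  simp [rowMajor, toMat, finProdFinEquiv_symm_apply, Fin.coe_divNat, Fin.coe_modNat]

/-- **The code of a `GapSVP` instance with a natural threshold**: `code (I, t) = ⟨code I, ⟨smE t, bin 1⟩⟩`
(the rational `t` has numerator `t` and denominator `1`). [cite: MicciancioGoldwasser2002, Ch. 1 Def. 1.4 / §1.2] -/
theorem gapSVPInstance_encode_natCast (I : LatticeInstance) (t : ℕ) :
    GapSVPInstance.encode (I, (t : ℚ)) = boolPair I.encode (boolPair (smE (t : ℤ)) (encodeNat 1)) := by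
  show boolPair I.encode (boolPair (encodingIntBool.encode (t : ℚ).num) (encodeNat (t : ℚ).den)) = _
  rw [Rat.num_natCast, Rat.den_natCast]
  rfl

/-! ### Polynomial time -/

/-- **`(1ᴺ, X) ↦ rowMajor N X`** on codes: a `map` over the unary-bounded range `[0, N²)` of the entry
access `ent X (m / N) (m % N)`. [cite: AroraBarak2009, §1.3] -/
theorem rowMajorFP : CodeFP (pairE unE matE) (rawE intE) (fun p => rowMajor p.1 p.2) := by
  -- the entry, context `(N, X)` (binary `N`), item `m`
  have hg : CodeFP (pairE (pairE natE matE) natE) intE (fun t => ent t.1.2 (t.2 / t.1.1) (t.2 % t.1.1)) :=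
    (entFP.comp ((fst _ _).snd'.pair ((natDiv.comp ((snd _ _).pair (fst _ _).fst')).pair
      (natMod.comp ((snd _ _).pair (fst _ _).fst')))) :)
  -- the range `[0, N²)` from `1ᴺ`
  have hNN : CodeFP unE (rawE natE) (fun N => List.range (N * N)) :=
    (urange.comp ((ulength unitE).comp (unitsMul.comp (replicateUnit.pair replicateUnit)))).congr fun N => by
      simp
  exact ((map hg).comp (((natOfUn.comp (fst _ _)).pair (snd _ _)).pair (hNN.comp (fst _ _)))).congr fun p => rfl

/-- **The lattice instance of a table is coded in polynomial time**: `(1ᴺ, X) ↦ code ⟨N, toMat N N X⟩`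
(binary dimension header, unary length header, entries converted from difference pairs to
sign–magnitude). [cite: AroraBarak2009, §1.3; MicciancioGoldwasser2002, Ch. 1 §1.2] -/
theorem latticeTableFP : CodeFP (pairE unE matE) strE (fun p => LatticeInstance.encode ⟨p.1, toMat p.1 p.1 p.2⟩) := by
  have hsm : CodeFP (rawE intE) (listE smE) (fun l => l) :=
    ((listOfRaw smE).comp (map₀ smOfInt)).congr fun l => by simp
  have h1 : CodeFP (pairE unE matE) (pairE natE (listE smE)) (fun p => (p.1, rowMajor p.1 p.2)) :=
    (natOfUn.comp (fst _ _)).pair (hsm.comp rowMajorFP)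
  exact h1.recodeOut fun p => by rw [latticeInstance_encode_toMat]; rfl

/-- **A `GapSVP` instance from a table and a natural threshold is coded in polynomial time**:
`((1ᴺ, X), t) ↦ code (⟨N, toMat N N X⟩, t)` (`t` in binary). [cite: AroraBarak2009, §1.3; MicciancioGoldwasser2002, Ch. 1 Def. 1.4 / §1.2] -/
theorem gapSVPTableFP : CodeFP (pairE (pairE unE matE) natE) strE
    (fun p => GapSVPInstance.encode (⟨p.1.1, toMat p.1.1 p.1.1 p.1.2⟩, (p.2 : ℚ))) := by
  have hthr : CodeFP natE (pairE smE natE) (fun t => ((t : ℤ), 1)) :=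
    ((smOfInt.comp intOfNat).pair (const natE 1)).congr fun t => rfl
  have h := (latticeTableFP.comp (fst (pairE unE matE) natE)).pair (hthr.comp (snd _ _))
  exact h.recodeOut fun p => by rw [gapSVPInstance_encode_natCast]; rfl

end Literature.Algebra.EuclideanLattices
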